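import Summits.Ventures.PercRepro.SixThreePair

/-!
# PercRepro — the pair-witness bounds, part B: `planesOf`, `D_pair_le`, `D_pair_le_generic` (p2, gen 6)

Continuation of `SixThreePair.lean` (split for the 400-line file limit; proofs unchanged).
-/

namespace PercRepro

namespace SixThree

open Finset ThmH

variable {α : Type*} [DecidableEq α] {M : Matroid α} [M.Finite]

/-- The planes `P ≠ G` whose trace on `S` has rank `3` (the planes of `M|S` other than `G`). -/
noncomputable def planesOf (M : Matroid α) [M.Finite] (G S : Finset α) : Finset (Finset α) :=
  ((planes M).erase G).filter (fun P => M.eRk ((S ∩ P : Finset α) : Set α) = 3)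

/-- Only the planes of `M|S` contribute to the sum over `planes M ∖ {G}`. -/
theorem sum_erase_eq_sum_planesOf (G S : Finset α) :
    ∑ P ∈ (planes M).erase G, fRule M P S = ∑ P ∈ planesOf M G S, fRule M P S := by
  unfold planesOf
  rw [Finset.sum_filter]
  apply Finset.sum_congr rfl
  intro P _
  by_cases h : M.eRk ((S ∩ P : Finset α) : Set α) = 3
  · rw [if_pos h]
  · rw [if_neg h]
    unfold fRule
    rw [if_neg h]

/-- A line of `M|B` lies in the plane `G ⊇ B` (`ρ(B) = 3`). -/
theorem linesOf_subset_plane (hs : Simple M) {G B L : Finset α} (hG : G ∈ planes M) (hB : B ⊆ G)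
    (hrB : M.eRk (B : Set α) = 3) (hL : L ∈ linesOf M B) : L ⊆ G := by
  unfold linesOf at hL
  rw [Finset.mem_filter] at hL
  have hr2 : M.eRk ((L ∩ B : Finset α) : Set α) = 2 :=
    eRk_eq_two_of_subset_line hs hL.1 Finset.inter_subset_left hL.2
  have hcl := closure_eq_of_subset_line hL.1 Finset.inter_subset_left hr2
  rw [← Finset.coe_subset, ← hcl]
  calc M.closure ((L ∩ B : Finset α) : Set α) ⊆ M.closure (B : Set α) :=
        M.closure_subset_closure (Finset.coe_subset.2 Finset.inter_subset_right)
    _ = (G : Set α) := closure_eq_of_subset_plane hG hB hrB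

/-- **The pair bound, parametrised by the fibre constant `c`**: with `S = B ∪ {x, x′}`, if every line `L` of `M|B`
receives at most `c · 6^{|L ∩ B| − 2}` from the planes `P ≠ G` with `P ∩ B = L ∩ B`, then
`D(S) ≤ 6^{|B| − 3} + c · Λ(B) + |B|` (the planes with `|P ∩ B| ≤ 1` are the `cl({a, x, x′})`, `a ∈ B`, of trace `3`). -/
theorem D_pair_le_of_fibre (hs : Simple M) {G B : Finset α} (hG : G ∈ planes M) (hB : B ⊆ G)
    (hrB : M.eRk (B : Set α) = 3) {x x' : α} (hxx' : x ≠ x')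
    (hxG : x ∉ G) (hx'G : x' ∉ G) (c : ℚ)
    (hfib : ∀ L ∈ linesOf M B, ∀ F : Finset (Finset α), (∀ P ∈ F, P ∈ planes M ∧ P ≠ G ∧
      M.eRk (((insert x (insert x' B)) ∩ P : Finset α) : Set α) = 3 ∧ P ∩ B = L ∩ B ∧ L ⊆ P) →
      ∑ P ∈ F, fRule M P (insert x (insert x' B)) ≤ c * (6 : ℚ) ^ ((L ∩ B).card - 2)) :
    D M (insert x (insert x' B)) ≤ (6 : ℚ) ^ (B.card - 3) + c * Lam M B + B.card := by
  classical
  have hBg : B ⊆ gr M := hB.trans (mem_planes.1 hG).1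
  unfold D
  rw [← Finset.add_sum_erase (planes M) _ hG, fRule_eq_of_inter (pair_inter_eq hB hxG hx'G) hrB,
    sum_erase_eq_sum_planesOf, add_assoc]
  apply add_le_add (le_refl _)
  set S := insert x (insert x' B) with hS
  set A := planesOf M G S with hA
  have hAdata : ∀ P ∈ A, P ∈ planes M ∧ P ≠ G ∧ M.eRk ((S ∩ P : Finset α) : Set α) = 3 := by
    intro P hP
    rw [hA, planesOf, Finset.mem_filter, Finset.mem_erase] at hP
    exact ⟨hP.1.2, hP.1.1, hP.2⟩
  rw [← Finset.sum_filter_add_sum_filter_not A (fun P => M.eRk ((P ∩ B : Finset α) : Set α) = 2)]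
  apply add_le_add
  · -- the rank-2 traces, fibred over their lines
    set A₂ := A.filter (fun P => M.eRk ((P ∩ B : Finset α) : Set α) = 2) with hA₂
    have hA₂data : ∀ P ∈ A₂, P ∈ planes M ∧ P ≠ G ∧ M.eRk ((S ∩ P : Finset α) : Set α) = 3 ∧
        M.eRk ((P ∩ B : Finset α) : Set α) = 2 := by
      intro P hP
      rw [hA₂, Finset.mem_filter] at hP
      exact ⟨(hAdata P hP.1).1, (hAdata P hP.1).2.1, (hAdata P hP.1).2.2, hP.2⟩
    have hmaps : ∀ P ∈ A₂, clF M (P ∩ B) ∈ linesOf M B := by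
      intro P hP
      obtain ⟨hPpl, hne, -, h2⟩ := hA₂data P hP
      obtain ⟨hL, hLB, -, -⟩ := line_of_trace hG hPpl hB hrB h2
      unfold linesOf
      rw [Finset.mem_filter, hLB]
      exact ⟨hL, two_le_card_of_eRk_eq_two h2⟩
    rw [← Finset.sum_fiberwise_of_maps_to hmaps]
    unfold Lam
    rw [Finset.mul_sum]
    apply Finset.sum_le_sum
    intro L hL
    apply hfib L hL
    intro P hP
    rw [Finset.mem_filter] at hP
    obtain ⟨hPpl, hne, hr3, h2⟩ := hA₂data P hP.1
    obtain ⟨-, hLB, -, hLP⟩ := line_of_trace hG hPpl hB hrB h2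
    rw [hP.2] at hLB hLP
    exact ⟨hPpl, hne, hr3, hLB.symm, hLP⟩
  · -- the traces of rank `≤ 1`: at most one plane `cl({a, x, x′})` per point `a ∈ B`, each of weight `1`
    set A₁ := A.filter (fun P => ¬ M.eRk ((P ∩ B : Finset α) : Set α) = 2) with hA₁
    have hA₁data : ∀ P ∈ A₁, P ∈ planes M ∧ P ≠ G ∧ M.eRk ((S ∩ P : Finset α) : Set α) = 3 ∧
        (P ∩ B).card ≤ 1 := by
      intro P hP
      rw [hA₁, Finset.mem_filter] at hP
      obtain ⟨hPpl, hne, hr3⟩ := hAdata P hP.1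
      refine ⟨hPpl, hne, hr3, ?_⟩
      apply card_le_one_of_eRk_le_one hs (Finset.inter_subset_right.trans hBg)
      have hle2 := eRk_inter_le_two hG hPpl hne hB
      obtain ⟨k, hk, -⟩ := eRk_eq_nat M (P ∩ B)
      rw [hk] at hle2 hP ⊢
      have hk2 : k ≤ 2 := by exact_mod_cast hle2
      have hk2' : k ≠ 2 := fun h => hP.2 (by rw [h]; rfl)
      exact_mod_cast (show k ≤ 1 by omega)
    -- each such plane has trace exactly `{a, x, x′}`
    have hA₁trace : ∀ P ∈ A₁, (S ∩ P).card = 3 ∧ ∃ a ∈ B, S ∩ P = insert a {x, x'} := by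
      intro P hP
      obtain ⟨hPpl, hne, hr3, hcard1⟩ := hA₁data P hP
      have hsub : S ∩ P ⊆ (P ∩ B) ∪ {x, x'} := by
        rw [hS, pair_trace_eq]
        exact Finset.union_subset_union (Finset.Subset.refl _) Finset.inter_subset_right
      have hle3 : (S ∩ P).card ≤ 3 := by
        calc (S ∩ P).card ≤ ((P ∩ B) ∪ {x, x'}).card := Finset.card_le_card hsub
          _ ≤ (P ∩ B).card + ({x, x'} : Finset α).card := Finset.card_union_le _ _
          _ ≤ 1 + 2 := by rw [Finset.card_pair hxx']; omega
      have hge3 : 3 ≤ (S ∩ P).card := three_le_card_of_eRk_eq_three hr3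
      have hcard3 : (S ∩ P).card = 3 := le_antisymm hle3 hge3
      refine ⟨hcard3, ?_⟩
      -- `P ∩ B` is nonempty, so `P ∩ B = {a}`
      obtain ⟨a, ha⟩ : (P ∩ B).Nonempty := by
        rw [Finset.nonempty_iff_ne_empty]
        intro hempty
        have : S ∩ P ⊆ ({x, x'} : Finset α) := by
          intro y hy
          have := hsub hy
          rw [hempty, Finset.empty_union] at this
          exact this
        have := Finset.card_le_card this
        rw [Finset.card_pair hxx'] at this
        omega
      have hPB : P ∩ B = {a} := by
        apply Finset.eq_singleton_iff_unique_mem.2 ⟨ha, ?_⟩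
        intro y hy
        exact Finset.card_le_one.1 hcard1 y hy a ha
      refine ⟨a, (Finset.mem_inter.1 ha).2, ?_⟩
      apply Finset.eq_of_subset_of_card_le
      · rw [hPB] at hsub
        intro y hy
        have := hsub hy
        rw [Finset.mem_union, Finset.mem_singleton] at this
        rw [Finset.mem_insert]
        exact this
      · rw [hcard3]
        exact Finset.card_le_three
    have hterm : ∀ P ∈ A₁, fRule M P S = 1 := by
      intro P hP
      obtain ⟨-, -, hr3, -⟩ := hA₁data P hP
      obtain ⟨hcard3, -⟩ := hA₁trace P hP
      unfold fRule
      rw [if_pos hr3, hcard3]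
      norm_num
    have hA₁sub : A₁ ⊆ B.image (fun a => clF M (insert a {x, x'})) := by
      intro P hP
      obtain ⟨hPpl, -, hr3, -⟩ := hA₁data P hP
      obtain ⟨-, a, haB, hSP⟩ := hA₁trace P hP
      rw [Finset.mem_image]
      refine ⟨a, haB, ?_⟩
      apply Finset.coe_injective
      rw [coe_clF]
      have hsubP : insert a {x, x'} ⊆ P := by rw [← hSP]; exact Finset.inter_subset_right
      have hr3' : M.eRk ((insert a {x, x'} : Finset α) : Set α) = 3 := by rw [← hSP]; exact hr3
      exact closure_eq_of_subset_plane hPpl hsubP hr3'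
    calc ∑ P ∈ A₁, fRule M P S = ∑ _P ∈ A₁, (1 : ℚ) := Finset.sum_congr rfl hterm
      _ = (A₁.card : ℚ) := by rw [Finset.sum_const, nsmul_eq_mul, mul_one]
      _ ≤ (B.card : ℚ) := by
          have h1 : A₁.card ≤ (B.image (fun a => clF M (insert a {x, x'}))).card := Finset.card_le_card hA₁sub
          have h2 := Finset.card_image_le (s := B) (f := fun a => clF M (insert a {x, x'}))
          exact_mod_cast h1.trans h2

/-- **The pair bound** (the inequality half of mine-2 §19.2 (b)/(c)): for `B ⊆ G` of rank `3` and `x ≠ x′ ∉ G`,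
`D(B ∪ {x, x′}) ≤ 6^{|B| − 3} + 6 · Λ(B) + |B|`. -/
theorem D_pair_le (hs : Simple M) {G B : Finset α} (hG : G ∈ planes M) (hB : B ⊆ G)
    (hrB : M.eRk (B : Set α) = 3) {x x' : α} (hx : x ∈ gr M) (hx' : x' ∈ gr M) (hxx' : x ≠ x')
    (hxG : x ∉ G) (hx'G : x' ∉ G) :
    D M (insert x (insert x' B)) ≤ (6 : ℚ) ^ (B.card - 3) + 6 * Lam M B + B.card := by
  apply D_pair_le_of_fibre hs hG hB hrB hxx' hxG hx'G 6
  intro L hL F hF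
  have hLG := linesOf_subset_plane hs hG hB hrB hL
  have hL' : L ∈ lines M := (Finset.mem_filter.1 hL).1
  have hLcard : 2 ≤ (L ∩ B).card := (Finset.mem_filter.1 hL).2
  have h := (pair_fibre_le hs hG hB hrB hL' hLG hLcard hx hx' hxx' hxG hx'G F hF).1
  have hk : (L ∩ B).card - 1 = ((L ∩ B).card - 2) + 1 := by omega
  rw [hk, pow_succ] at h
  linarith

/-- **The generic pair bound** (mine-2 §19.2 (b)): if moreover `ρ(B ∪ {x, x′}) = 5`,
`D(B ∪ {x, x′}) ≤ 6^{|B| − 3} + 2 · Λ(B) + |B|`. -/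
theorem D_pair_le_generic (hs : Simple M) {G B : Finset α} (hG : G ∈ planes M) (hB : B ⊆ G)
    (hrB : M.eRk (B : Set α) = 3) {x x' : α} (hx : x ∈ gr M) (hx' : x' ∈ gr M) (hxx' : x ≠ x')
    (hxG : x ∉ G) (hx'G : x' ∉ G) (hr5 : M.eRk ((insert x (insert x' B) : Finset α) : Set α) = 5) :
    D M (insert x (insert x' B)) ≤ (6 : ℚ) ^ (B.card - 3) + 2 * Lam M B + B.card := by
  apply D_pair_le_of_fibre hs hG hB hrB hxx' hxG hx'G 2
  intro L hL F hF
  have hLG := linesOf_subset_plane hs hG hB hrB hL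
  have hL' : L ∈ lines M := (Finset.mem_filter.1 hL).1
  have hLcard : 2 ≤ (L ∩ B).card := (Finset.mem_filter.1 hL).2
  exact (pair_fibre_le hs hG hB hrB hL' hLG hLcard hx hx' hxx' hxG hx'G F hF).2 hr5

end SixThree

end PercRepro
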